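import Mathlib
import Summits.KontsevichZagierPeriods.KontsevichZagierPeriods.Theorems.SoloInformedSumStar
import Summits.KontsevichZagierPeriods.KontsevichZagierPeriods.Theorems.SoloInformedZetaOneTwoClass
import HarnessLib
import HarnessLib.Audit

/-!
# SoloInformed — the depth-two sum formula in the formal period ring, all weights (PROGRAMME XXXIX, file 5)

Solo programme `solo-KontsevichZagierPeriods-informed`, session s46.

**THEOREM XXXIX.** For every `n ≥ 3`, in Kontsevich–Zagier's formal period ring `𝒫`
(integral representations modulo the three rules),

  `∑_{a=2}^{n−1} mzvClass [a, n − a] = mzvClass [n]`.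

Proof (one telescope step + the order-cell engine): the telescope identity
`[R₁] − [R₂] ∈ relations` of the datum `(0, X₁⋯X_{n−2}, X_{n−1}, 1, (0,1)ⁿ)` (file 1); the chart
`λ` carries `R₁` to the garland `[(0,1)ⁿ ∩ P_E, g]`, whose order cells, sorted, are exactly the
simplex representations of `Z(n−1,1)` and `Z(a, n−a)`, `2 ≤ a ≤ n−2` (files 2–3); partial fractions
and the chart `κ` give `⟦R₂⟧ = mzvClass [n−1,1] + mzvClass [n]` (file 4); cancel `mzvClass [n−1,1]`.
Weight `3` (`ζ(2,1) = ζ(3)` in `𝒫`) is `soloInformed_mzvClass_euler3`.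

Applying the period map `KZ.evalP` recovers the numerical sum formula (Euler, Hoffman 1992), which
the Literature proves by series rearrangement (`multipleZeta_sum_formula_depth_two`); the content
here is that the identity already holds between the ABSTRACT periods, i.e. is a consequence of the
rules (1a) (1b) (2) (3) applied to the defining integral representations — an infinite family of
instances of the period conjecture decided unconditionally.

References: Kontsevich–Zagier 2001 §1.2 [KontsevichZagier2001]; M. Hoffman, Multiple harmonic
series, Pacific J. Math. 152 (1992), Thm 5.1; A. Granville, A decomposition of Riemann's zeta
function (1997).
-/

noncomputable section

open MeasureTheory Set MvPolynomial
open Literature.ModelTheory.ExponentialFields Literature.NumberTheory.Transcendental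
open Literature.NumberTheory.Transcendental.KZ

namespace Summit.KontsevichZagierPeriods.KontsevichZagierPeriods.Theorems

variable {m : ℕ}

/-- The slot sum, made explicit: `∑_{s ≠ 0} mzvClass (idx s) = mzvClass [m+3,1] + ∑_{i<m+2} mzvClass [i+2, m+2−i]`. -/
theorem soloInformed_sum_slots_eq :
    ∑ s ∈ Finset.univ.erase (0 : Fin (m + 4)), mzvClass (soloInformedSumIdx m s) =
      mzvClass [m + 3, 1] + ∑ i ∈ Finset.range (m + 2), mzvClass [i + 2, m + 2 - i] := by
  set F : ℕ → FormalPeriodRing :=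
    fun k => mzvClass (if k = m + 3 then [m + 3, 1] else [k + 1, m + 3 - k]) with hF
  have hidx : ∀ s : Fin (m + 4), mzvClass (soloInformedSumIdx m s) = F s := fun s => by
    simp only [hF, soloInformedSumIdx, Fin.ext_iff, Fin.val_last]
  rw [Finset.sum_congr rfl fun s _ => hidx s, Finset.sum_erase_eq_sub (Finset.mem_univ _),
    Fin.sum_univ_eq_sum_range (fun k => F k) (m + 4), Finset.sum_range_succ, Finset.sum_range_succ',
    Fin.val_zero]
  have hlast : F (m + 3) = mzvClass [m + 3, 1] := by simp [hF]
  have hmid : ∀ i ∈ Finset.range (m + 2), F (i + 1) = mzvClass [i + 2, m + 2 - i] := fun i hi => by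
    have hi' := Finset.mem_range.1 hi
    simp only [hF, if_neg (show i + 1 ≠ m + 3 by omega)]
    rw [show i + 1 + 1 = i + 2 by omega, show m + 3 - (i + 1) = m + 2 - i by omega]
  rw [Finset.sum_congr rfl hmid, hlast]
  abel

/-- **THEOREM XXXIX (m-form).** `∑_{i ≤ m+1} mzvClass [i+2, m+2−i] = mzvClass [m+4]` in `𝒫`. -/
theorem soloInformed_mzvClass_sumFormula_m (m : ℕ) :
    ∑ i ∈ Finset.range (m + 2), mzvClass [i + 2, m + 2 - i] = mzvClass [m + 4] := by
  have h : toFormalPeriod (of (soloInformedSumDatum m).R1) =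
      toFormalPeriod (of (soloInformedSumDatum m).R2) :=
    toFormalPeriod_eq_iff.2 (soloInformed_sum_telescope m)
  rw [soloInformed_sum_R1_class, soloInformed_sum_R2_class, soloInformed_sum_slots_eq] at h
  exact add_left_cancel h

/-- **THEOREM XXXIX (the depth-two sum formula in the formal period ring, every weight `n ≥ 3`).**
`∑_{i < n−2} mzvClass [i+2, n−2−i] = mzvClass [n]`, i.e. `∑_{a=2}^{n−1} ⟦Z(a, n−a)⟧ = ⟦Z(n)⟧`. -/
theorem soloInformed_mzvClass_sumFormula_depth2 (n : ℕ) (hn : 3 ≤ n) :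
    ∑ i ∈ Finset.range (n - 2), mzvClass [i + 2, n - 2 - i] = mzvClass [n] := by
  obtain ⟨k, rfl⟩ := Nat.exists_eq_add_of_le hn
  cases k with
  | zero => simpa using soloInformed_mzvClass_euler3
  | succ m =>
    rw [show 3 + (m + 1) - 2 = m + 2 by omega, show 3 + (m + 1) = m + 4 by omega]
    exact soloInformed_mzvClass_sumFormula_m m

/-- **COROLLARY (equality of abstract periods).** The classes of the two rational representations
"`⊔_{a=2}^{n−1} Z(a, n−a)`" and `Z(n)` agree in `𝒫` for every `n ≥ 3` — unconditionally, without
`KZPeriodConjecture`; numerically this is the sum formula `∑_{a=2}^{n−1} ζ(a, n−a) = ζ(n)`. -/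
theorem soloInformed_multipleZeta_sumFormula_depth2 (n : ℕ) (hn : 3 ≤ n) :
    ∑ i ∈ Finset.range (n - 2), multipleZeta [i + 2, n - 2 - i] = multipleZeta [n] := by
  have h := congrArg evalP (soloInformed_mzvClass_sumFormula_depth2 n hn)
  rw [map_sum] at h
  have hadm : ∀ i ∈ Finset.range (n - 2), MZV.IsAdmissible [i + 2, n - 2 - i] := fun i hi => by
    have := Finset.mem_range.1 hi
    exact ⟨fun j hj => by simp at hj; omega, fun _ => by simp⟩
  rw [Finset.sum_congr rfl fun i hi => evalP_mzvClass (hadm i hi),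
    evalP_mzvClass ⟨by simp; omega, fun _ => by simp; omega⟩] at h
  exact h

end Summit.KontsevichZagierPeriods.KontsevichZagierPeriods.Theorems
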